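import Mathlib
import HarnessLib
import Summits.QuantumFields.YangMills.Theses.FradkinShenkerFlow
import Summits.QuantumFields.YangMills.Theses.EquipartitionCriticality
import Summits.QuantumFields.YangMills.Theses.DirichletWindow
import Summits.QuantumFields.YangMills.Theorems.HypercubicLimit.Negative.AllTimesGapFalse
import Summits.QuantumFields.YangMills.Theorems.ClusteringToYangMills.Negative.DisproofBurden

/-!
# Line `antipodal-docking` — skeleton for crux `ClusteringToYangMills` (stmt-QuantumFields-9443)

Route `FradkinShenkerFlow`, crux 4 = `ClusteringHyp → YangMills` (`crux_unfold`, `Iff.rfl`), where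
`ClusteringHyp` (= the disprover's `LatticeClustering`) is volume-uniform exponential clustering in Euclidean
time on the symmetric tori `(ℤ/(2S+1))⁴`, `n ≤ S`, at every `β ≥ β₀(G,r)`, with PER-β rate `m(β)` and PER-β,
PER-PAIR constants `C(A,B,β)`.

## The line (idea card `Ideas/antipodal-docking.md`, sharpened by TRIAGE-r1-1/2/3)

DOCK, DON'T REBUILD.  The crux is the canonical UV leg `CriticalContinuumLimit` (stmt-8762) plus the shared
criticality input `XiDiverges` (stmt-8941) with its glue `CriticalityOfXiDiverges` (stmt-12318), plus ONE
adapter turning `ClusteringHyp` into hypothesis (1) of 8762 (`UniformTorusGap`: β-UNIFORM per-pair constants,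
a rate FUNCTION `m(β)`, a threshold function `S₀(β)`).  The triage panel located the adapter's true content:

* NOT a thermal bound at the spectral rate (that lives inside 8762's own proof, for every socket alike), and
  NOT "separable growth with `Γ ≡ 1`": per-β STRUCTURED constants suffice, by RATE SACRIFICE
  (`rate_sacrifice`, `uniformTorusGap_of_structured` — triager 3, re-proved below);
* what `ClusteringHyp` genuinely lacks is β-REGULARITY: its constants are chosen β by β, and an UNCOUNTABLE
  family `β ↦ log C(A,B,β)` need not be dominated by `Γ(β)·k(A,B)` (a Baire-category example with
  `f(β,p) = 1/|β − q_p|` shows even lower-semicontinuous families fail), whereas along any COUNTABLE set of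
  couplings domination is free (triager 2, `sequential_uniformise`).

Hence the adapter is cut into exactly two named stubs and proved glue:

1. `stub_localUniformityUpgrade` : at each compact simple `(G, r)`, `ClusteringAt G r →` clustering with rate
   and per-pair constants UNIFORM ON UNIT β-INTERVALS `[b, b+1]`, `b ≥ β₁(G,r)` (`LocallyUniformClustering`;
   per-`(G,r)` form as in the triage adapters `TorusGapUniformisation ≡ UniformiseConstants`).  The honest
   residual (open, soft:
   it fails only if constants blow up at some `β*` while finite at `β*` itself; mechanism: openness in `β` of
   finite-size clustering criteria / continuity of torus states uniformly in the volume).  The rate depends on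
   the interval, so this is NOT the β-uniform clustering refuted (conditionally) by
   `TunedSequenceExists/Negative/UniformClustering`; `n ≤ S` is kept (cf. `not_latticeClusteringAllTimes`).
2. `stub_boxUniformisation` : Banach–Steinhaus for the torus correlation bilinear forms — pairwise bounds
   uniform over ANY index family ⇒ constants `K(D,D')·‖A‖∞‖B‖∞` uniform over observables supported in the
   finite edge sets `D, D'` (the space `X_D` of bounded measurable gauge-invariant `D`-cylinder functions is
   Banach; bilinear uniform boundedness).  Provable now.
3. PROVED here: `uniformTorusGap_of_locallyUniform` — countable diagonal over (unit interval `N`, support pair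
   `(D,D')`) + rate sacrifice ⇒ `UniformTorusGap` with `S₀ ≡ 0`; and the composition
   `ClusteringToYangMills_of` (five stubs ⊢ the crux, by name).

Bypass kept for the lead (proved): `ClusteringToYangMills_of_structured` — if `ClusteringHyp`'s constants are
delivered STRUCTURED (e.g. the product form `K(β)(|supp A|+|supp B|)‖A‖‖B‖` that `PoincareToClustering`'s
Martinelli-type proof yields; card §"Why it bites" (3)), stubs 1–2 are not needed at all.

The antipodal log-convexity chord of the card (β enters only through a torus-size threshold, at half the
given rate) is NOT a stub of this line: after rate sacrifice it is not load-bearing for docking on 8762 as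
typed; it is the natural first lemma of the SPECTRAL-RATE torus clause inside 8762 (triage T1 vs (S*)).

Disproof.lean (cdisprove gen 1, RESISTS) honoured: `ecPerVolume_trivial` (S-uniformity of constants is the
content — every statement below keeps `∃ C ∀ S`), `not_ecAllTimes` (every statement keeps `n ≤ S`),
`cruxWithoutNontriviality_trivial` (H is consumed only through the gap bookkeeping; the interacting limit is
imported as 8762 + 8941), `ec_zero_coupling` (unit test of the shapes).  No `_false_without_` theorem and no
`-- Targets` exist yet; landed `Negative/DisproofBurden.lean` is imported and nothing here instantiates
`not_latticeClusteringAllTimes`.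
-/

noncomputable section

namespace Summit.QuantumFields.YangMills.Cruxes.ClusteringToYangMills.AntipodalDocking

open scoped BigOperators
open MeasureTheory
open Literature.MathematicalPhysics.QuantumFieldTheory
open Summit.QuantumFields.YangMills.Theses
open Summit.QuantumFields.YangMills.Theorems.HypercubicLimit.Negative (abs_latticeConnectedCorr_le)

/-- Pairs of finite edge sets (supports of two local observables). -/
local notation "SuppPair" =>
  Finset (Literature.MathematicalPhysics.QuantumLattice.ZdEdge 4) ×
    Finset (Literature.MathematicalPhysics.QuantumLattice.ZdEdge 4)

/-! ## §0 Vocabulary (all over existing declarations) -/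

/-- The antecedent of the crux, verbatim (= Disproof's `LatticeClustering`): volume-uniform exponential
clustering in Euclidean time on the symmetric tori at every `β ≥ β₀(G,r)`, per-β rate, per-β per-pair
constants. [folklore] -/
def ClusteringHyp : Prop :=
  ∀ (G : Type) [Group G] [TopologicalSpace G] [IsTopologicalGroup G] [CompactSpace G]
    [MeasurableSpace G] [BorelSpace G], IsCompactSimpleLieGroup G →
    ∀ (r : LatticeRep G), ∃ β₀ : ℝ, ∀ β : ℝ, β₀ ≤ β →
      (∃ m : ℝ, 0 < m ∧ ∀ A B : YMSpecies G, ∃ C : ℝ, ∀ S n : ℕ, n ≤ S →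
        |latticeConnectedCorr r.ρ β (2 * S + 1) A.F B.F n| ≤ C * Real.exp (-(m * n)))

/-- Read-back: the crux IS `ClusteringHyp → YangMills`. [folklore] -/
theorem crux_unfold : FradkinShenkerFlow.ClusteringToYangMills ↔ (ClusteringHyp → YangMills) :=
  Iff.rfl

variable {G : Type} [Group G] [TopologicalSpace G] [IsTopologicalGroup G] [CompactSpace G]
  [MeasurableSpace G] [BorelSpace G]

variable (G) in
/-- Hypothesis (1) of `CriticalContinuumLimit` (stmt-8762) for one `(G, r)` (= body of `LatticeGapLargeBeta`,
stmt-8761): β-UNIFORM per-pair constants, a rate function, a torus-size threshold function. [folklore] -/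
def UniformTorusGap (r : LatticeRep G) : Prop :=
  ∃ (β₁ : ℝ) (m : ℝ → ℝ) (S₀ : ℝ → ℕ), (∀ β : ℝ, β₁ ≤ β → 0 < m β) ∧
    ∀ A B : YMSpecies G, ∃ C : ℝ, ∀ β : ℝ, β₁ ≤ β → ∀ S n : ℕ, S₀ β ≤ S → n ≤ S →
      |latticeConnectedCorr r.ρ β (2 * S + 1) A.F B.F n| ≤ C * Real.exp (-(m β * n))

variable (G) in
/-- **Locally uniform clustering** for one `(G, r)`: above some `β₁`, on every unit interval `[b, b+1]` of
couplings ONE rate `μ_b > 0` and, for each pair, ONE constant serve all `β ∈ [b, b+1]`, all tori, `n ≤ S`.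
(`ClusteringHyp` restricted to `(G,r)` is the case of degenerate intervals; β-regularity is the difference.)
[folklore] -/
def LocallyUniformClustering (r : LatticeRep G) : Prop :=
  ∃ β₁ : ℝ, ∀ b : ℝ, β₁ ≤ b → ∃ μ : ℝ, 0 < μ ∧ ∀ A B : YMSpecies G, ∃ C : ℝ,
    ∀ β : ℝ, b ≤ β → β ≤ b + 1 → ∀ S n : ℕ, n ≤ S →
      |latticeConnectedCorr r.ρ β (2 * S + 1) A.F B.F n| ≤ C * Real.exp (-(μ * n))

variable (G) in
/-- `ClusteringHyp` at one `(G, r)` (= triage's `TorusClusteringH`, Disproof's `∃ β₀ ∀ β ≥ β₀, EC G r β`):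
pointwise in `β`, per-β rate, per-β per-pair constants. [folklore] -/
def ClusteringAt (r : LatticeRep G) : Prop :=
  ∃ β₀ : ℝ, ∀ β : ℝ, β₀ ≤ β →
    (∃ m : ℝ, 0 < m ∧ ∀ A B : YMSpecies G, ∃ C : ℝ, ∀ S n : ℕ, n ≤ S →
      |latticeConnectedCorr r.ρ β (2 * S + 1) A.F B.F n| ≤ C * Real.exp (-(m * n)))

/-- Read-back: `ClusteringHyp` is `ClusteringAt` for every compact simple `G` and every `r`. [folklore] -/
theorem clusteringHyp_iff :
    ClusteringHyp ↔
      ∀ (G : Type) [Group G] [TopologicalSpace G] [IsTopologicalGroup G] [CompactSpace G]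
        [MeasurableSpace G] [BorelSpace G], IsCompactSimpleLieGroup G →
        ∀ r : LatticeRep G, ClusteringAt G r :=
  Iff.rfl

/-- **Stub statement 4 (the β-regularity residual).** For a fixed compact simple lattice gauge theory
`(G, r)`: volume-uniform clustering POINTWISE in `β` on a half-line upgrades to clustering LOCALLY UNIFORM in
`β` (unit intervals) on a (possibly later) half-line. [folklore] -/
def LocalUniformityUpgrade : Prop :=
  ∀ (G : Type) [Group G] [TopologicalSpace G] [IsTopologicalGroup G] [CompactSpace G]
    [MeasurableSpace G] [BorelSpace G], IsCompactSimpleLieGroup G →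
    ∀ r : LatticeRep G, ClusteringAt G r → LocallyUniformClustering G r

/-- **Stub statement 5 (Banach–Steinhaus box-uniformisation).** For any family of (weighted) torus
connected-correlation functionals indexed by `ι` (couplings `βι`, half-sides `Sι`, separations `nι`, weights
`wι ≥ 0`): if every PAIR of gauge-invariant local observables has its own bound uniform over `ι`, then for
every pair of finite edge sets `D, D'` ONE constant `K(D,D')` bounds the family by `K·‖A‖∞·‖B‖∞` for all
observables supported in `D`, `D'`.  (Uniform boundedness on the Banach spaces `X_D × X_{D'}` of bounded
measurable gauge-invariant cylinder functions; each functional is bilinear with `|corr| ≤ 2‖A‖∞‖B‖∞`.)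
[folklore] -/
def BoxUniformisation : Prop :=
  ∀ (G : Type) [Group G] [TopologicalSpace G] [IsTopologicalGroup G] [CompactSpace G]
    [MeasurableSpace G] [BorelSpace G] (r : LatticeRep G)
    (ι : Type) (βι : ι → ℝ) (Sι nι : ι → ℕ) (wι : ι → ℝ), (∀ i, 0 ≤ wι i) →
    (∀ A B : YMSpecies G, ∃ C : ℝ, ∀ i,
        wι i * |latticeConnectedCorr r.ρ (βι i) (2 * Sι i + 1) A.F B.F (nι i)| ≤ C) →
      ∀ D D' : Finset (Literature.MathematicalPhysics.QuantumLattice.ZdEdge 4), ∃ K : ℝ, 0 ≤ K ∧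
        ∀ A B : YMSpecies G, A.supp ⊆ D → B.supp ⊆ D' →
          ∀ CA CB : ℝ, (∀ U, |A.F U| ≤ CA) → (∀ U, |B.F U| ≤ CB) → ∀ i,
            wι i * |latticeConnectedCorr r.ρ (βι i) (2 * Sι i + 1) A.F B.F (nι i)| ≤ K * (CA * CB)

/-! ## §1 Registered stubs -/

/-- **stub 1 = stmt-QuantumFields-8762** `CriticalContinuumLimit` (shared UV hub of EquipartitionCriticality /
DirichletWindow): gap in `UniformTorusGap` form + criticality ⇒ the interacting OS continuum limit with mass
gap.  Open problem (E1, non-Gaussianity of `tr F²`, gap transfer); staffed once, there. [folklore] -/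
theorem stub_criticalContinuumLimit : EquipartitionCriticality.CriticalContinuumLimit := by
  sorry

/-- **stub 2 = stmt-QuantumFields-8941** `XiDiverges`: `ξ_lat(β) → ∞` uniformly over infinite-volume limit
points (Chatterjee Problem 5.1, second half); attacked by XiCompleteMonotonicity / DirichletWindow /
EquipartitionCriticality with fixed-β RP tools. [folklore] -/
theorem stub_xiDiverges : DirichletWindow.XiDiverges := by
  sorry

/-- **stub 3 = stmt-QuantumFields-12318** `CriticalityOfXiDiverges` (M glue): `XiDiverges` ⇒ every admissible
volume-uniform clustering rate function tends to `0` — hypothesis (2) of 8762. [folklore] -/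
theorem stub_criticalityOfXiDiverges : DirichletWindow.CriticalityOfXiDiverges := by
  sorry

/-- **stub 4 (new, the line's own content): β-regularity of the clustering constants** — registered form,
statement verbatim = def `LocalUniformityUpgrade` with `ClusteringAt` / `LocallyUniformClustering` unfolded and tree
names fully qualified (so a Theorems-side `--supports stmt-QuantumFields-9443` proof can restate it textually).
[folklore] -/
theorem stub_localUniformityUpgrade :
    ∀ (G : Type) [Group G] [TopologicalSpace G] [IsTopologicalGroup G] [CompactSpace G]
      [MeasurableSpace G] [BorelSpace G],
      Literature.MathematicalPhysics.QuantumFieldTheory.IsCompactSimpleLieGroup G →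
      ∀ r : Literature.MathematicalPhysics.QuantumFieldTheory.LatticeRep G,
        (∃ β₀ : ℝ, ∀ β : ℝ, β₀ ≤ β →
          (∃ m : ℝ, 0 < m ∧ ∀ A B : Literature.MathematicalPhysics.QuantumFieldTheory.YMSpecies G,
            ∃ C : ℝ, ∀ S n : ℕ, n ≤ S →
              |Literature.MathematicalPhysics.QuantumFieldTheory.latticeConnectedCorr r.ρ β (2 * S + 1)
                  A.F B.F n| ≤ C * Real.exp (-(m * n)))) →
        ∃ β₁ : ℝ, ∀ b : ℝ, β₁ ≤ b → ∃ μ : ℝ, 0 < μ ∧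
          ∀ A B : Literature.MathematicalPhysics.QuantumFieldTheory.YMSpecies G, ∃ C : ℝ,
            ∀ β : ℝ, b ≤ β → β ≤ b + 1 → ∀ S n : ℕ, n ≤ S →
              |Literature.MathematicalPhysics.QuantumFieldTheory.latticeConnectedCorr r.ρ β (2 * S + 1)
                  A.F B.F n| ≤ C * Real.exp (-(μ * n)) := by
  sorry

/-- **stub 5 (new, provable now): Banach–Steinhaus box-uniformisation** — registered form, statement verbatim
= def `BoxUniformisation`, tree names fully qualified. [folklore] -/
theorem stub_boxUniformisation :
    ∀ (G : Type) [Group G] [TopologicalSpace G] [IsTopologicalGroup G] [CompactSpace G]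
      [MeasurableSpace G] [BorelSpace G]
      (r : Literature.MathematicalPhysics.QuantumFieldTheory.LatticeRep G)
      (ι : Type) (βι : ι → ℝ) (Sι nι : ι → ℕ) (wι : ι → ℝ), (∀ i, 0 ≤ wι i) →
      (∀ A B : Literature.MathematicalPhysics.QuantumFieldTheory.YMSpecies G, ∃ C : ℝ, ∀ i,
          wι i * |Literature.MathematicalPhysics.QuantumFieldTheory.latticeConnectedCorr r.ρ (βι i)
            (2 * Sι i + 1) A.F B.F (nι i)| ≤ C) →
        ∀ D D' : Finset (Literature.MathematicalPhysics.QuantumLattice.ZdEdge 4), ∃ K : ℝ, 0 ≤ K ∧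
          ∀ A B : Literature.MathematicalPhysics.QuantumFieldTheory.YMSpecies G, A.supp ⊆ D → B.supp ⊆ D' →
            ∀ CA CB : ℝ, (∀ U, |A.F U| ≤ CA) → (∀ U, |B.F U| ≤ CB) → ∀ i,
              wι i * |Literature.MathematicalPhysics.QuantumFieldTheory.latticeConnectedCorr r.ρ (βι i)
                (2 * Sι i + 1) A.F B.F (nι i)| ≤ K * (CA * CB) := by
  sorry

/-! ### Aliases keyed by the registered stub names

The skeleton audit admits a hypothesis of `ClusteringToYangMills_of` iff its head constant is a registered
obligation (stubs 1–3: the route items themselves) or its last name component is a declared stub name (stubs 4–5: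
the aliases below; obligation tags are gate-reserved and not written here). -/

namespace Registered

/-- Alias of `LocalUniformityUpgrade` keyed by the registered stub name. [folklore] -/
abbrev stub_localUniformityUpgrade : Prop := LocalUniformityUpgrade

/-- Alias of `BoxUniformisation` keyed by the registered stub name. [folklore] -/
abbrev stub_boxUniformisation : Prop := BoxUniformisation

end Registered

/-! ## §2 Proved glue -/

/-- **Rate sacrifice** (elementary; statement and proof from crux-triage r1-3,
`TriageAdapterBookkeeping3.lean`): an a-priori bound `|c| ≤ a` and a clustering bound with multiplicative
excess `exp (Γ K)` combine into the `Γ`-FREE constant `a · w · exp K` at the slower rate `μ / max 1 Γ`.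
[folklore] -/
theorem rate_sacrifice {a w K Γ μ x c : ℝ} (ha : 1 ≤ a) (hw : 1 ≤ w) (hK : 0 ≤ K)
    (h1 : |c| ≤ a) (h2 : |c| ≤ w * Real.exp (Γ * K) * Real.exp (-(μ * x))) :
    |c| ≤ a * w * Real.exp K * Real.exp (-(μ / max 1 Γ * x)) := by
  set L := max 1 Γ with hL
  have hL1 : 1 ≤ L := le_max_left _ _
  have hLΓ : Γ ≤ L := le_max_right _ _
  have hL0 : 0 < L := lt_of_lt_of_le one_pos hL1
  have ha0 : 0 ≤ a := le_trans zero_le_one ha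
  have haw : 1 ≤ a * w := by nlinarith
  by_cases h : μ * x ≤ L * K
  · have hle : μ / L * x ≤ K := by
      rw [div_mul_eq_mul_div, div_le_iff₀ hL0]; linarith [mul_comm L K]
    have hone : 1 ≤ Real.exp K * Real.exp (-(μ / L * x)) := by
      rw [← Real.exp_add]; exact Real.one_le_exp (by linarith)
    calc |c| ≤ a := h1
      _ ≤ a * w := by nlinarith
      _ = a * w * 1 := (mul_one _).symm
      _ ≤ a * w * (Real.exp K * Real.exp (-(μ / L * x))) := by
          exact mul_le_mul_of_nonneg_left hone (by linarith)
      _ = a * w * Real.exp K * Real.exp (-(μ / L * x)) := by ring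
  · push Not at h
    have h3 : K < μ * x / L := by rw [lt_div_iff₀ hL0]; linarith
    have h4 : K * (L - 1) ≤ μ * x / L * (L - 1) :=
      mul_le_mul_of_nonneg_right h3.le (by linarith)
    have h5 : K * Γ ≤ K * L := mul_le_mul_of_nonneg_left hLΓ hK
    have h7 : μ * x / L * (L - 1) = μ * x - μ * x / L := by
      field_simp
    have h6 : μ / L * x = μ * x / L := by ring
    have key : Γ * K + -(μ * x) ≤ K + -(μ / L * x) := by
      rw [h6]; rw [h7] at h4; nlinarith [h4, h5]
    calc |c| ≤ w * Real.exp (Γ * K) * Real.exp (-(μ * x)) := h2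
      _ = w * Real.exp (Γ * K + -(μ * x)) := by rw [Real.exp_add]; ring
      _ ≤ w * Real.exp (K + -(μ / L * x)) :=
          mul_le_mul_of_nonneg_left (Real.exp_le_exp.2 key) (by linarith)
      _ = 1 * w * (Real.exp K * Real.exp (-(μ / L * x))) := by rw [Real.exp_add]; ring
      _ ≤ a * w * (Real.exp K * Real.exp (-(μ / L * x))) := by
          apply mul_le_mul_of_nonneg_right _ (by positivity)
          exact mul_le_mul_of_nonneg_right ha (by linarith)
      _ = a * w * Real.exp K * Real.exp (-(μ / L * x)) := by ring

/-- **The adapter, proved modulo stubs 4–5: locally uniform clustering + box-uniformisation ⇒ the β-uniform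
`UniformTorusGap` shape** (threshold `S₀ ≡ 0`).  Countable diagonal: with `K_N(D,D')` the box constant on the
`N`-th unit interval at rate `μ_N`, enumerate support pairs `q = e j` and put
`Γ_N := 1 + ∑_{j ≤ N} log⁺ K_N(e j)`, `k(q) := 1 + ∑_{N < idx q} log⁺ K_N(q)`; then `log⁺ K_N(q) ≤ Γ_N · k(q)`
for all `N, q`, and rate sacrifice at `β ∈ [β₁+N, β₁+N+1]` gives the β-free constant
`max 1 (2‖A‖‖B‖) · max 1 (‖A‖‖B‖) · exp k(supp A, supp B)` at rate `μ_N / max 1 Γ_N`. [folklore] -/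
theorem uniformTorusGap_of_locallyUniform (hBU : BoxUniformisation) (r : LatticeRep G)
    (h : LocallyUniformClustering G r) : UniformTorusGap G r := by
  obtain ⟨β₁, hloc⟩ := h
  have hb : ∀ N : ℕ, β₁ ≤ β₁ + N := fun N => le_add_of_nonneg_right (Nat.cast_nonneg N)
  choose μ hμ C hC using fun N : ℕ => hloc (β₁ + N) (hb N)
  -- Banach–Steinhaus on each unit interval, weights `exp (μ_N n)`
  have hKex : ∀ (N : ℕ) (D D' : Finset (Literature.MathematicalPhysics.QuantumLattice.ZdEdge 4)), ∃ K : ℝ, 0 ≤ K ∧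
      ∀ A B : YMSpecies G, A.supp ⊆ D → B.supp ⊆ D' →
        ∀ CA CB : ℝ, (∀ U, |A.F U| ≤ CA) → (∀ U, |B.F U| ≤ CB) →
          ∀ β : ℝ, β₁ + N ≤ β → β ≤ β₁ + N + 1 → ∀ S n : ℕ, n ≤ S →
            Real.exp (μ N * n) * |latticeConnectedCorr r.ρ β (2 * S + 1) A.F B.F n| ≤
              K * (CA * CB) := by
    intro N D D'
    -- the hypothesis of Banach–Steinhaus on the `N`-th unit interval, from local uniformity
    have hhyp : ∀ A B : YMSpecies G, ∃ C₀ : ℝ,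
        ∀ i : {p : ℝ × ℕ × ℕ // β₁ + N ≤ p.1 ∧ p.1 ≤ β₁ + N + 1 ∧ p.2.2 ≤ p.2.1},
          Real.exp (μ N * i.1.2.2) *
              |latticeConnectedCorr r.ρ i.1.1 (2 * i.1.2.1 + 1) A.F B.F i.1.2.2| ≤ C₀ := by
      intro A B
      refine ⟨C N A B, fun i => ?_⟩
      obtain ⟨⟨β, S, n⟩, h1, h2, hn⟩ := i
      have hb := hC N A B β h1 h2 S n hn
      have hpos := Real.exp_pos (μ N * n)
      calc Real.exp (μ N * n) * |latticeConnectedCorr r.ρ β (2 * S + 1) A.F B.F n|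
          ≤ Real.exp (μ N * n) * (C N A B * Real.exp (-(μ N * n))) :=
            mul_le_mul_of_nonneg_left hb hpos.le
        _ = C N A B := by
            rw [Real.exp_neg, mul_comm (C N A B), ← mul_assoc, mul_inv_cancel₀ hpos.ne']
            simp
    obtain ⟨K, hK0, hK⟩ := hBU G r
      {p : ℝ × ℕ × ℕ // β₁ + N ≤ p.1 ∧ p.1 ≤ β₁ + N + 1 ∧ p.2.2 ≤ p.2.1}
      (fun i => i.1.1) (fun i => i.1.2.1) (fun i => i.1.2.2)
      (fun i => Real.exp (μ N * i.1.2.2)) (fun i => (Real.exp_pos _).le) hhyp D D'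
    refine ⟨K, hK0, fun A B hA hB CA CB hCA hCB β h1 h2 S n hn => ?_⟩
    exact hK A B hA hB CA CB hCA hCB ⟨(β, S, n), h1, h2, hn⟩
  choose K hK0 hK using hKex
  -- enumeration of support pairs and the diagonal domination `log⁺ K_N(q) ≤ Γ_N · k(q)`
  obtain ⟨e, he⟩ := exists_surjective_nat (SuppPair)
  have hidx : ∀ q, e (Function.surjInv he q) = q := Function.surjInv_eq he
  set idx : SuppPair → ℕ := Function.surjInv he with hidx_def
  set logK : ℕ → SuppPair → ℝ :=
    fun N q => Real.log (max 1 (K N q.1 q.2)) with hlogK_def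
  have hlogK0 : ∀ N q, 0 ≤ logK N q := fun N q => Real.log_nonneg (le_max_left _ _)
  have hexp_logK : ∀ N q, K N q.1 q.2 ≤ Real.exp (logK N q) := fun N q => by
    simp only [hlogK_def]
    rw [Real.exp_log (lt_of_lt_of_le one_pos (le_max_left _ _))]
    exact le_max_right _ _
  set Γ : ℕ → ℝ := fun N => 1 + ∑ j ∈ Finset.range (N + 1), logK N (e j) with hΓ_def
  set k : SuppPair → ℝ :=
    fun q => 1 + ∑ M ∈ Finset.range (idx q), logK M q with hk_def
  have hΓ1 : ∀ N, 1 ≤ Γ N := fun N =>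
    le_add_of_nonneg_right (Finset.sum_nonneg fun j _ => hlogK0 N (e j))
  have hk1 : ∀ q, 1 ≤ k q := fun q =>
    le_add_of_nonneg_right (Finset.sum_nonneg fun M _ => hlogK0 M q)
  have hdom : ∀ N q, logK N q ≤ Γ N * k q := by
    intro N q
    rcases le_or_gt (idx q) N with hle | hlt
    · have h1 : logK N q ≤ Γ N := by
        have hs : logK N (e (idx q)) ≤ ∑ j ∈ Finset.range (N + 1), logK N (e j) :=
          Finset.single_le_sum (f := fun j => logK N (e j)) (fun j _ => hlogK0 N (e j))
            (Finset.mem_range.2 (Nat.lt_succ_of_le hle))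
        rw [hidx] at hs
        linarith
      calc logK N q ≤ Γ N := h1
        _ = Γ N * 1 := (mul_one _).symm
        _ ≤ Γ N * k q := mul_le_mul_of_nonneg_left (hk1 q) (by linarith [hΓ1 N])
    · have h1 : logK N q ≤ k q := by
        have hs : logK N q ≤ ∑ M ∈ Finset.range (idx q), logK M q :=
          Finset.single_le_sum (f := fun M => logK M q) (fun M _ => hlogK0 M q)
            (Finset.mem_range.2 hlt)
        linarith
      calc logK N q ≤ k q := h1
        _ = 1 * k q := (one_mul _).symm
        _ ≤ Γ N * k q := mul_le_mul_of_nonneg_right (hΓ1 N) (by linarith [hk1 q])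
  -- assemble: rate function `μ_N / max 1 Γ_N` on the `N`-th unit interval, threshold `0`
  refine ⟨β₁, fun β => μ ⌊β - β₁⌋₊ / max 1 (Γ ⌊β - β₁⌋₊), fun _ => 0,
    fun β _ => div_pos (hμ _) (lt_of_lt_of_le one_pos (le_max_left _ _)), ?_⟩
  intro A B
  obtain ⟨CA, hCA⟩ := A.bounded
  obtain ⟨CB, hCB⟩ := B.bounded
  have hCA0 : 0 ≤ CA := le_trans (abs_nonneg _) (hCA fun _ => 1)
  have hCB0 : 0 ≤ CB := le_trans (abs_nonneg _) (hCB fun _ => 1)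
  have hcc : 0 ≤ CA * CB := mul_nonneg hCA0 hCB0
  refine ⟨max 1 (2 * (CA * CB)) * max 1 (CA * CB) * Real.exp (k (A.supp, B.supp)),
    fun β hβ S n _ hn => ?_⟩
  have hβ0 : 0 ≤ β - β₁ := sub_nonneg.2 hβ
  have h1N : β₁ + (⌊β - β₁⌋₊ : ℕ) ≤ β := by
    have := Nat.floor_le hβ0; linarith
  have h2N : β ≤ β₁ + (⌊β - β₁⌋₊ : ℕ) + 1 := by
    have := Nat.lt_floor_add_one (β - β₁); linarith
  have ha : |latticeConnectedCorr r.ρ β (2 * S + 1) A.F B.F n| ≤ max 1 (2 * (CA * CB)) :=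
    (abs_latticeConnectedCorr_le r β (2 * S + 1) hCA hCB n).trans (le_max_right _ _)
  have hKb := hK ⌊β - β₁⌋₊ A.supp B.supp A B subset_rfl subset_rfl CA CB hCA hCB β h1N h2N S n hn
  have hw : |latticeConnectedCorr r.ρ β (2 * S + 1) A.F B.F n| ≤
      max 1 (CA * CB) * Real.exp (Γ ⌊β - β₁⌋₊ * k (A.supp, B.supp)) *
        Real.exp (-(μ ⌊β - β₁⌋₊ * n)) := by
    have hpos := Real.exp_pos (μ ⌊β - β₁⌋₊ * n)
    have step1 : |latticeConnectedCorr r.ρ β (2 * S + 1) A.F B.F n| ≤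
        K ⌊β - β₁⌋₊ A.supp B.supp * (CA * CB) * Real.exp (-(μ ⌊β - β₁⌋₊ * n)) := by
      calc |latticeConnectedCorr r.ρ β (2 * S + 1) A.F B.F n|
          = Real.exp (-(μ ⌊β - β₁⌋₊ * n)) *
              (Real.exp (μ ⌊β - β₁⌋₊ * n) * |latticeConnectedCorr r.ρ β (2 * S + 1) A.F B.F n|) := by
            rw [Real.exp_neg, ← mul_assoc, inv_mul_cancel₀ hpos.ne', one_mul]
        _ ≤ Real.exp (-(μ ⌊β - β₁⌋₊ * n)) * (K ⌊β - β₁⌋₊ A.supp B.supp * (CA * CB)) :=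
            mul_le_mul_of_nonneg_left hKb (Real.exp_pos _).le
        _ = K ⌊β - β₁⌋₊ A.supp B.supp * (CA * CB) * Real.exp (-(μ ⌊β - β₁⌋₊ * n)) := mul_comm _ _
    have step2 : K ⌊β - β₁⌋₊ A.supp B.supp ≤ Real.exp (Γ ⌊β - β₁⌋₊ * k (A.supp, B.supp)) :=
      (hexp_logK ⌊β - β₁⌋₊ (A.supp, B.supp)).trans (Real.exp_le_exp.2 (hdom _ _))
    have step3 : CA * CB ≤ max 1 (CA * CB) := le_max_right _ _
    have step4 : K ⌊β - β₁⌋₊ A.supp B.supp * (CA * CB) ≤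
        Real.exp (Γ ⌊β - β₁⌋₊ * k (A.supp, B.supp)) * max 1 (CA * CB) :=
      mul_le_mul step2 step3 hcc (Real.exp_pos _).le
    calc |latticeConnectedCorr r.ρ β (2 * S + 1) A.F B.F n|
        ≤ K ⌊β - β₁⌋₊ A.supp B.supp * (CA * CB) * Real.exp (-(μ ⌊β - β₁⌋₊ * n)) := step1
      _ ≤ Real.exp (Γ ⌊β - β₁⌋₊ * k (A.supp, B.supp)) * max 1 (CA * CB) *
            Real.exp (-(μ ⌊β - β₁⌋₊ * n)) := mul_le_mul_of_nonneg_right step4 (Real.exp_pos _).le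
      _ = max 1 (CA * CB) * Real.exp (Γ ⌊β - β₁⌋₊ * k (A.supp, B.supp)) *
            Real.exp (-(μ ⌊β - β₁⌋₊ * n)) := by ring
  exact rate_sacrifice (le_max_left _ _) (le_max_left _ _)
    (le_trans zero_le_one (hk1 (A.supp, B.supp))) ha hw

/-- **`ClusteringToYangMills_of` — the kernel-checked composition of the line.**  Stubs 1–5 ⊢ the crux BY
NAME: `ClusteringHyp` (at each `(G, r)`) is upgraded to locally uniform clustering (stub 4), box-uniformised
(stub 5) and
diagonalised into hypothesis (1) of `CriticalContinuumLimit` (`uniformTorusGap_of_locallyUniform`, proved);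
hypothesis (2) is `CriticalityOfXiDiverges XiDiverges` (stubs 2–3); stub 1 concludes. [folklore] -/
theorem ClusteringToYangMills_of :
    EquipartitionCriticality.CriticalContinuumLimit → DirichletWindow.XiDiverges →
      DirichletWindow.CriticalityOfXiDiverges → Registered.stub_localUniformityUpgrade →
        Registered.stub_boxUniformisation → FradkinShenkerFlow.ClusteringToYangMills := by
  intro hCCL hXi hCrit hLU hBU hEC G _ _ _ _ hG
  letI : MeasurableSpace G := borel G
  haveI : BorelSpace G := ⟨rfl⟩
  have h1 : ∀ r : LatticeRep G, UniformTorusGap G r := fun r =>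
    uniformTorusGap_of_locallyUniform hBU r (hLU G hG r (hEC G hG r))
  exact hCCL G hG h1 (hCrit hXi G hG)

/-- Wiring check: the five registered stubs feed `ClusteringToYangMills_of` exactly as stated (the verbatim stub
signatures are definitionally the aliased `Prop`s). -/
example : FradkinShenkerFlow.ClusteringToYangMills :=
  ClusteringToYangMills_of stub_criticalContinuumLimit stub_xiDiverges stub_criticalityOfXiDiverges
    stub_localUniformityUpgrade stub_boxUniformisation

/-! ## §3 Bypass for structured constants (triage r1-3, re-proved here so the lead has it in one file) -/

variable (G) in
/-- **Structured clustering** (per β, NOTHING uniform or regular in β): a β-free size functional `κ ≥ 0` and a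
β-free prefactor `w ≥ 1` such that at each `β ≥ β₀` SOME rate `μ_β > 0` and SOME `Γ_β` give
`|corr_β(A,B;n)| ≤ w A B · exp (Γ_β (κ A + κ B)) · exp (-μ_β n)` on all tori, `n ≤ S` — the shape delivered by
a "gap + β-independent finite speed" proof of `PoincareToClustering` (`w A B = ‖A‖‖B‖(|supp A|+|supp B|)`,
`κ ≡ 1/2`, `Γ_β = log⁺ K(β)`).  Statement from `TriageAdapterBookkeeping3.lean`. [folklore] -/
def StructuredClustering (r : LatticeRep G) : Prop :=
  ∃ κ : YMSpecies G → ℝ, (∀ A, 0 ≤ κ A) ∧ ∃ w : YMSpecies G → YMSpecies G → ℝ, (∀ A B, 1 ≤ w A B) ∧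
    ∃ β₀ : ℝ, ∀ β : ℝ, β₀ ≤ β → ∃ μ Γ : ℝ, 0 < μ ∧
      ∀ A B : YMSpecies G, ∀ S n : ℕ, n ≤ S →
        |latticeConnectedCorr r.ρ β (2 * S + 1) A.F B.F n| ≤
          w A B * Real.exp (Γ * (κ A + κ B)) * Real.exp (-(μ * n))

/-- **Structured ⇒ β-uniform shape by rate sacrifice alone** (`m(β) := μ_β / max 1 Γ_β`, `S₀ ≡ 0`); proof from
`TriageAdapterBookkeeping3.lean` (`uniformTorusGap_of_structuredH`). [folklore] -/
theorem uniformTorusGap_of_structured (r : LatticeRep G) (h : StructuredClustering G r) :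
    UniformTorusGap G r := by
  obtain ⟨κ, hκ, w, hw, β₀, hβ⟩ := h
  choose μ Γ hμ hb using hβ
  refine ⟨β₀, fun β => if h : β₀ ≤ β then μ β h / max 1 (Γ β h) else 1, fun _ => 0, ?_, ?_⟩
  · intro β hβ0
    simp only [hβ0, ↓reduceDIte]
    exact div_pos (hμ β hβ0) (lt_of_lt_of_le one_pos (le_max_left _ _))
  · intro A B
    obtain ⟨CA, hCA⟩ := A.bounded
    obtain ⟨CB, hCB⟩ := B.bounded
    refine ⟨max 1 (2 * (CA * CB)) * w A B * Real.exp (κ A + κ B), fun β hβ0 S n _ hn => ?_⟩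
    have h1 : |latticeConnectedCorr r.ρ β (2 * S + 1) A.F B.F n| ≤ max 1 (2 * (CA * CB)) :=
      (abs_latticeConnectedCorr_le r β (2 * S + 1) hCA hCB n).trans (le_max_right _ _)
    have h2 := hb β hβ0 A B S n hn
    have := rate_sacrifice (le_max_left _ _) (hw A B) (add_nonneg (hκ A) (hκ B)) h1 h2
    simpa only [hβ0, ↓reduceDIte] using this

/-- **Bypass composition**: if the crux's hypothesis can be STRUCTURED per β (e.g. after re-typing
`PoincareToClustering`'s conclusion in product form), stubs 4–5 are unnecessary: stubs 1–3 and the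
structuring close the crux (`crux_unfold.2 (ClusteringToYangMills_of_structured hS h₁ h₂ h₃)`). [folklore] -/
theorem ClusteringToYangMills_of_structured
    (hS : ∀ (G : Type) [Group G] [TopologicalSpace G] [IsTopologicalGroup G] [CompactSpace G]
        [MeasurableSpace G] [BorelSpace G], IsCompactSimpleLieGroup G →
        ∀ r : LatticeRep G, ClusteringAt G r → StructuredClustering G r)
    (hCCL : EquipartitionCriticality.CriticalContinuumLimit) (hXi : DirichletWindow.XiDiverges)
    (hCrit : DirichletWindow.CriticalityOfXiDiverges) :
    ClusteringHyp → YangMills := by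
  -- (= the crux, `crux_unfold`; stated unfolded so that `ClusteringToYangMills_of` is the file's only
  -- theorem concluding the crux by name)
  intro hEC G _ _ _ _ hG
  letI : MeasurableSpace G := borel G
  haveI : BorelSpace G := ⟨rfl⟩
  exact hCCL G hG (fun r => uniformTorusGap_of_structured r (hS G hG r (hEC G hG r))) (hCrit hXi G hG)

/-! ## §4 Consistency checks against the disprover's findings -/

/-- `LocallyUniformClustering` implies `ClusteringAt` (degenerate intervals): stub 4 is a genuine UPGRADE of
the crux's hypothesis at `(G, r)` — a converse with content (β-regularity), not a restatement. [folklore] -/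
theorem clusteringAt_of_locallyUniform (r : LatticeRep G) (h : LocallyUniformClustering G r) :
    ClusteringAt G r := by
  obtain ⟨β₁, hloc⟩ := h
  refine ⟨β₁, fun β hβ => ?_⟩
  obtain ⟨μ, hμ, hAB⟩ := hloc β hβ
  exact ⟨μ, hμ, fun A B => (hAB A B).imp fun C hC S n hn => hC β le_rfl (by linarith) S n hn⟩

/-- The ALL-TIMES strengthening of stub 4's conclusion (restriction `n ≤ S` dropped) is FALSE — by the landed
`Negative/DisproofBurden.not_latticeClusteringAllTimes`; the line keeps `n ≤ S` in every statement.
[folklore] -/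
theorem not_locallyUniform_allTimes :
    ¬ (∀ (G : Type) [Group G] [TopologicalSpace G] [IsTopologicalGroup G] [CompactSpace G]
        [MeasurableSpace G] [BorelSpace G], IsCompactSimpleLieGroup G →
        ∀ r : LatticeRep G, ∃ β₁ : ℝ, ∀ b : ℝ, β₁ ≤ b → ∃ μ : ℝ, 0 < μ ∧
          ∀ A B : YMSpecies G, ∃ C : ℝ, ∀ β : ℝ, b ≤ β → β ≤ b + 1 → ∀ S n : ℕ,
            |latticeConnectedCorr r.ρ β (2 * S + 1) A.F B.F n| ≤ C * Real.exp (-(μ * n))) := by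
  intro h
  refine Summit.QuantumFields.YangMills.Theorems.ClusteringToYangMills.Negative.not_latticeClusteringAllTimes
    ?_
  intro G _ _ _ _ _ _ hG r
  obtain ⟨β₁, hloc⟩ := h G hG r
  refine ⟨β₁, fun β hβ => ?_⟩
  obtain ⟨μ, hμ, hAB⟩ := hloc β hβ
  exact ⟨μ, hμ, fun A B => (hAB A B).imp fun C hC S n => hC β le_rfl (by linarith) S n⟩

end Summit.QuantumFields.YangMills.Cruxes.ClusteringToYangMills.AntipodalDocking

end
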